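import Summits.BirchSwinnertonDyer.Rank1Residual.X11b.Three.ZhangAtThreeNonsplit
import Summits.BirchSwinnertonDyer.BirchSwinnertonDyer.Theorems.RungK2Hub
import Literature.NumberTheory.EllipticCurves.Rank1Residual.X9NoEntry
import Literature.NumberTheory.EllipticCurves.BSDSelmerSkinnerProofs

/-!
# Route `ClassRecordThree` (rung K2@3, D-0059) — the KOLYVAGIN ROAD on atom A1, stated over the class record's
# vocabulary (cell `bsd-stepL`, seat `bsd-stepL-koly` g6; `--supports stmt-BirchSwinnertonDyer-19106`)

Helper for the crux `Theses.ClassRecordThree.SchneiderAtThree` (item 19106; road (a): Schneider's conjecture at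
3 on the NON-SPLIT (ram) locus) and for the (ram) ∧ split clause of `HalvesAtThree` (item 19107): on the atom
A1 = `ClassX11b W 3 ∧ Ram W 3 ∧ 3 ∤ ∏ c_ℓ` (split OR non-split at 3; TRUE-OPEN 1 116 classes N < 5·10⁵,
class-wide 248 943 — the planner's census of record, STATUS 2026-08-25T21:53:59Z) the Kolyvagin road gives
STEP L in INDEX currency — `X11b.IndexLowerBoundAt W 3 K P`, i.e. `2·ord₃[E(K):ℤy_K] ≤ ord₃ #Ш(E/K) + 2·ord₃ ∏c`
— from the typed conjecture `Koly.ZhangAtThreeSharp W K` (`X11b/Three/ZhangAtThreeNonsplit.lean`, p408750;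
memo `koly/MEMO-v4.md`, referee g17 PASS) and the McCallum structure fact, WITHOUT Schneider's conjecture and
without any anticyclotomic main conjecture. This file only UNPACKS the class record's predicates
(`ClassX11b` = `r_an = 1 ∧ p ≠ 2 ∧ Mult ∧ Irr`; `Surj` from `Irr ∧ Ram` by the tree theorem
`surj_of_irr_of_ram`; non-CM from a multiplicative prime by `not_hasCM_of_hasMultiplicativeReductionAtPrime'`)
in front of the tree kernel `Koly.exists_indexLowerBoundAt_three_of_zhangAtThreeSharp_of_mccallum`; nothing new
is asserted. The further descent `IndexLowerBoundAt → BSDp W 3` is the tree's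
`X11b.bsdp_of_indexLowerBoundAt_of_heegnerData_of_odd` (`X11b/BDPRouteRigidity.lean`), whose Heegner-datum
plumbing (`heegnerPointComplex` vs the Kolyvagin datum's `derivedPoint`) is NOT composed here. Route files may
import only `Theorems.*`; this module makes the koly road's kernel statement available to them (an
ALTERNATIVE decomposition of the K2@3 rung on A1 would name it in place of `SchneiderAtThree`'s non-split clause).
-/

noncomputable section

open scoped Classical

namespace Summit.BirchSwinnertonDyer.Rank1Residual.X11b.Three.Koly

open WeierstrassCurve Literature.NumberTheory.EllipticCurves
  Literature.NumberTheory.EllipticCurves.ModularForms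
  Literature.NumberTheory.EllipticCurves.Rank1Residual
  Summit.BirchSwinnertonDyer.Rank1Residual Summit.BirchSwinnertonDyer.Rank1Residual.X11b
  Summit.BirchSwinnertonDyer.Rank1Residual.X11b.Three

/-- **The Kolyvagin road on A1, class-record vocabulary (supports `SchneiderAtThree` ∕ `HalvesAtThree`).**
For `(E, 3)` in class X11b (`ClassX11b W 3`: `r_an = 1`, `3 ∥ N` multiplicative — split OR non-split —,
`E[3]` irreducible) with a (ram) witness (`Ram W 3`) and `3 ∤ ∏ c_ℓ`, an imaginary quadratic Heegner field
`K` for `N_E` with `d_K ∉ {−3, −4}`, `E(K)` of rank one without 3-torsion and `Ш(E/K)` finite: IF the typed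
conjecture `Koly.ZhangAtThreeSharp W K` (Kolyvagin's conjecture mod 3 at `3 ∥ N`, memo MEMO-v4) holds and the
McCallum structure fact `hMc` holds, THEN some modular parametrisation datum gives, for its conductor-`1`
Kolyvagin–Heegner point `P = y_K` (of infinite order, `3^{M₀} ∥ P` in `E(K)`), the STEP-L inequality
`X11b.IndexLowerBoundAt W 3 K P`. Unpacking: `Surj W 3` from `Irr ∧ Ram` (`surj_of_irr_of_ram`, Serre +
Tate-curve inertia), non-CM from the multiplicative prime 3 (`not_hasCM_of_hasMultiplicativeReductionAtPrime'`);
then the tree kernel `Koly.exists_indexLowerBoundAt_three_of_zhangAtThreeSharp_of_mccallum` verbatim.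
CONDITIONAL on `hZ` (open conjecture, typed) and `hMc` (LINE-K named fact). [folklore]
[cite: McCallumLMS1991, §5 Cor. 5.6 (p. 310)] [cite: WZhang2014, Thm. 1.1 (p. 195) — shape of `hZ` only] -/
theorem exists_indexLowerBoundAt_three_of_classX11b_of_zhangAtThreeSharp_of_mccallum
    (W : WeierstrassCurve ℚ) [W.IsElliptic] [W.IsGloballyMinimal] [NeZero (W.conductorNorm ℤ)]
    (K : Type) [Field K] [NumberField K]
    (hX : ClassX11b W 3) (hram : Ram W 3) (htam : ¬ 3 ∣ W.tamagawaProduct)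
    (hZ : ZhangAtThreeSharp W K) (hMc : McCallum1991_pow_dvd_card_sha_primary_of_certificate)
    (hK : IsImaginaryQuadratic K) (hH : SatisfiesHeegnerHypothesis (W.conductorNorm ℤ) K)
    (h3 : NumberField.discr K ≠ -3) (h4 : NumberField.discr K ≠ -4)
    (hrank : (W.baseChange K).mordellWeilRank = 1)
    (hiv : ∀ x : (W.baseChange K).toAffine.Point, 3 • x = 0 → x = 0)
    [Finite (W.baseChange K).sha] :
    ∃ (Dt : ModularParametrizationData W (W.conductorNorm ℤ)) (β : ℤ) (ι : K →+* ℂ),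
      ∀ (d₁ : KolyvaginHeegnerData Dt β ι 1) (P : (W.baseChange K).toAffine.Point),
        d₁.toGeomPoints d₁.derivedPoint = toGeomPoints (W.baseChange K) P →
        ¬ IsOfFinAddOrder P →
        ∀ (M₀ : ℕ), (∃ Q : (W.baseChange K).toAffine.Point, ((3 ^ M₀ : ℕ) : ℤ) • Q = P) →
          (¬ ∃ Q : (W.baseChange K).toAffine.Point, ((3 ^ (M₀ + 1) : ℕ) : ℤ) • Q = P) →
          IndexLowerBoundAt W 3 K P := by
  obtain ⟨-, -, hmult, hirr⟩ := hX
  have hρ : Surj W 3 := surj_of_irr_of_ram W 3 hirr hram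
  have hCM : ¬ W.HasCM := not_hasCM_of_hasMultiplicativeReductionAtPrime' W hmult
  exact exists_indexLowerBoundAt_three_of_zhangAtThreeSharp_of_mccallum W K hZ hMc hmult hρ hram
    htam hK hH h3 h4 hCM hrank hiv

/-- **The non-split clause in `SchneiderAtThree`'s own binders** (item 19106's domain:
`ClassX11b W 3 → Ram W 3 → ¬ split at 3`): on its intersection with A1 (`3 ∤ ∏ c_ℓ`) the Kolyvagin road's
STEP L needs neither the split/non-split distinction nor the 3-adic height — the previous theorem with the
non-split binder carried and unused (bookkeeping, so that a route decomposition can quote the clause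
verbatim). CONDITIONAL on `hZ`, `hMc`. [folklore] -/
theorem exists_indexLowerBoundAt_three_of_schneiderClause_of_zhangAtThreeSharp_of_mccallum
    (W : WeierstrassCurve ℚ) [W.IsElliptic] [W.IsGloballyMinimal] [NeZero (W.conductorNorm ℤ)]
    (K : Type) [Field K] [NumberField K]
    (hX : ClassX11b W 3) (hram : Ram W 3) (_hns : ¬ W.HasSplitMultiplicativeReductionAtPrime 3)
    (htam : ¬ 3 ∣ W.tamagawaProduct)
    (hZ : ZhangAtThreeSharp W K) (hMc : McCallum1991_pow_dvd_card_sha_primary_of_certificate)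
    (hK : IsImaginaryQuadratic K) (hH : SatisfiesHeegnerHypothesis (W.conductorNorm ℤ) K)
    (h3 : NumberField.discr K ≠ -3) (h4 : NumberField.discr K ≠ -4)
    (hrank : (W.baseChange K).mordellWeilRank = 1)
    (hiv : ∀ x : (W.baseChange K).toAffine.Point, 3 • x = 0 → x = 0)
    [Finite (W.baseChange K).sha] :
    ∃ (Dt : ModularParametrizationData W (W.conductorNorm ℤ)) (β : ℤ) (ι : K →+* ℂ),
      ∀ (d₁ : KolyvaginHeegnerData Dt β ι 1) (P : (W.baseChange K).toAffine.Point),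
        d₁.toGeomPoints d₁.derivedPoint = toGeomPoints (W.baseChange K) P →
        ¬ IsOfFinAddOrder P →
        ∀ (M₀ : ℕ), (∃ Q : (W.baseChange K).toAffine.Point, ((3 ^ M₀ : ℕ) : ℤ) • Q = P) →
          (¬ ∃ Q : (W.baseChange K).toAffine.Point, ((3 ^ (M₀ + 1) : ℕ) : ℤ) • Q = P) →
          IndexLowerBoundAt W 3 K P :=
  exists_indexLowerBoundAt_three_of_classX11b_of_zhangAtThreeSharp_of_mccallum W K hX hram htam hZ hMc hK
    hH h3 h4 hrank hiv

end Summit.BirchSwinnertonDyer.Rank1Residual.X11b.Three.Koly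

end
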